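import Literature.AlgebraicGeometry.ShimuraVarieties.KudlaRapoport2013.Sec2Defs
import HarnessLib

/-!
# Kudla–Rapoport, *Special cycles on unitary Shimura varieties II: global theory* — §2 «The global moduli problem»
# (arXiv 0912.3758 **v2** = J. reine angew. Math. 697 (2014), pp. 7–15 of v2) — SECTION CARPET (statements only, no proofs)

[KudlaRapoport2013] = S. Kudla, M. Rapoport, *Special cycles on unitary Shimura varieties II: global theory*, J. reine angew.
Math. **697** (2014) 91–157, doi 10.1515/crelle-2012-0121 = arXiv:0912.3758.  SOURCE OF RECORD FOR THIS FILE: arXiv **v2**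
(«last revised 18 Dec 2012», 60 pp., the version of record — Rapoport–Smithling–Zhang cite the Crelle numbering «[31, §2.3]»,
«[31, Rem. 4.2]», which is v2's), extracted page by page into the squad kit `T/KR/TKR-t01/g0/KR2013-arxiv-v2-pages.TKR-t01-g0.txt`
(sha16 cab423ad46aa69e3; «p. N» below = arXiv v2 page N = the running-head page); symbols re-read on the held TeX text
`paper:arxiv-0912.3758` (arXiv v1, chunks p0006–p0010), whose §2 STATEMENTS agree with v2 word for word (only the proof of
Lemma 2.21 differs).  NUMBERING = v2 = print.  **v1 ↔ v2 concordance for §2** (the tree's 36 older `KudlaRapoport2013` §2 tags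
use v1 numbers): v1 has an extra Remark 2.2 (Larsen), so v1 item 2.k = v2 item 2.(k−1) for k ≥ 3 — v2 Ex. 2.2 = v1 Ex. 2.3,
v2 Def. 2.4 (wedge) = v1 Def. 2.5, v2 Thm. 2.5 (Pappas) = v1 Thm. 2.6, v2 Not. 2.6 = v1 2.7, v2 Lem. 2.7 = v1 2.8, v2 Def. 2.8 =
v1 2.9, v2 Prop. 2.9 = v1 2.10, v2 Lem. 2.10/2.11 = v1 2.11/2.12, v2 Prop. 2.12 = v1 2.13, v2 Rem. 2.13 = v1 2.14, v2 Prop. 2.14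
(Jacobowitz) = v1 2.15, v2 Rem. 2.15 = v1 2.16, v2 Cor. 2.16 = v1 2.17, v2 Lem. 2.17 = v1 2.18, v2 Def. 2.18 = v1 2.19, v2 Prop.
2.19 = v1 2.20, v2 Lem. 2.20/2.21 = v1 2.21/2.22, v2 Prop. 2.22 = v1 2.23; displays (2.1)–(2.6) of v2 = v1 (2.1), (2.2)=wedge,
(2.3), (2.4)=`h'`, (2.5)=`h'(x,x)=T`, (2.6)=`2h_λ`.

## What this file is (squad TKR, seat TKR-t01, deal sheet `SPLIT-TKR.v1` row t01)

The VOCABULARY of §2 — the datum `Sec2Core k` / `Sec2Data C`, the REAL objects `NaiveObj`, `Obj`, `M0Obj`, `MObj`, `ZObj`, `HomOK`,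
`SelfDualLattice`, `IsRelevant`, `RelevantSharp`, `HermIso`, `HermStrictSim`, `IsTypeII`, `IsPosDefHerm`, `diff0`, `sigmaInt`, … — is the
sibling file `Sec2Defs` (imported; read its module docstring for the carrier discipline); THIS file types every numbered item of §2
over it.  The carpet of §2 in the discipline of the sibling carpets (`RapoportSmithlingZhang2020.Sec3IntegralModels`, same field shapes so
that §4 / RSZ consumers can bridge): a datum in TWO PARTS — `structure Sec2Core k` carrying the REAL numerics `n ≥ 1`,
`0 ≤ r ≤ n` and the ⟨CARRIER⟩ clause predicates / functions that Mathlib and the tree cannot evaluate on a general base (all TOTAL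
with inhabited codomains), and `structure Sec2Data (C : Sec2Core k)` carrying the OBJECT-DEPENDENT labels of Prop. 2.12 / 2.19,
defined on objects only (the signature = Kottwitz
condition (2.1) and the wedge condition (2.2) on `Lie A`, the Rosati condition, pull-back of polarizations, the hermitian form
`h'` (2.4), the Tate-module forms of §2.3, the hermitian-space label `V(ξ)` of the proof of Prop. 2.12, genera of self-dual
lattices, local orbits and local invariants, supersingularity, and the six STACK-LEVEL SENTENCES of Prop. 2.1 / Rem. 2.3 /
Thm. 2.5 / Prop. 2.9 recorded as tokens in `StackSentences` — Deligne–Mumford stacks, smoothness/flatness of stacks have no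
vocabulary in Mathlib or the tree); over it, the OBJECTS of the moduli problems `M(n−r,r)^naive(S)`, `M(n−r,r)(S)`, `M₀(S)`,
`M(S)`, `Z(T)(S)` are REAL structures (★ `AbelianSchemeOver S`, ★ `RingAction (𝓞 k)`, ★ `DualPair` / `Polarization`, principal
= `IsIso λ`) over an `O_k`-scheme `f : S → Spec O_k`; hermitian spaces over `k` are the tree's ★ `Liu2021.AppendixC.HermSpace ℚ k`
(REAL `form`, `sig`, `conj`), self-dual `O_k`-lattices, relevance, isometry, strict similarity, type I/II, `δ`, `Diff₀(T)`,
inert/ramified primes are REAL definitions; every numbered Definition / Lemma / Proposition / Theorem / Corollary of §2 is a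
`def … (C : Sec2Core k) : Prop` / `def … (D : Sec2Data C) : Prop` PREDICATE on the consumer's datum (a consumer takes
`(h : C.Lemma27)` for ITS OWN `C`; `∀ C, …` is never the printed statement and is never claimed).  NOTHING IS ASSERTED, nothing is proved.

CITED, NOT RESTATED (dedup): the signature FUNCTION of (2.1) / §4.1 and its reflex field — ★
`Literature.NumberTheory.ComplexMultiplication.KudlaRapoportSignatureReflexField` (`adjoin_sum_eq_fieldRange_of_kr_of_finrank_eq_two`:
`E = k` for `1 ≤ n ≠ 2`, `adjoin_sum_eq_bot_of_kr_of_finrank_eq_two`: `E = ℚ` for signature `(1,1)`) and its siblings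
`KottwitzSignatureReflexField{Degree,RationalOrCM}`, `CMTypeSubfieldTracesReflexField{Degree,RationalOrCM}`,
`KottwitzDeterminantPolynomialIntegrality` (the right side of (2.1) lies in `O_k[T]`), and under `Literature/AlgebraicGeometry/
ComplexMultiplication/` the `EndomorphismField*` files (Lie-algebra signature of an `O_k`-action: `…LieAlgebraSignature`,
`…SignatureBalanced`, `…SignatureConjugateTwist` = the conjugation twist after Ex. 2.2, `…DeterminantCondition`); the
chart-free characteristic polynomial of `ι(a)` on `Lie A` over a LOCAL affine base is ★ `AbelianSchemeOver.lieCharpoly`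
(`AbelianSchemes/AbelianSchemeCotangentCharpoly`), by which a consumer EVALUATES the ⟨CARRIER⟩ `IsSignature` locally.

## INDEX — every item of §2 (v2 pp. 7–15) ↦ declaration (★ = elsewhere in the tree; «recorded» = printed stack-level sentence
kept as a token of `StackSentences`, no vocabulary to type it)

§2.1 (pp. 7–8): the groupoid `M(n−r,r)^naive` over `(Sch/Spec O_k)` ↦ `Sec2Core.NaiveObj`, `NaiveObj.Iso`, `NaiveObj.baseChange`; signature
condition (2.1) ↦ ⟨CARRIER⟩ `Sec2Core.IsSignature` (★ files above for the signature function); «`A` is of relative dimension `n`» ↦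
`relDim_of_signature`; **Prop. 2.1** ↦ `Prop21` (recorded tokens); **Ex. 2.2** (`M₀`) ↦ `M0Obj`, `Ex22_polarizationUnique`,
`Ex22_endomorphisms` (coarse moduli space `Spec O_H` recorded in the docstring); the conjugation isomorphism
`M(n−r,r)^naive ≅ M(r,n−r)^naive` (after Ex. 2.2) ↦ `conjugationIso`; **Rem. 2.3** (Pappas: not flat for `n ≥ 3`) ↦ `Rem23`
(recorded token); **Def. 2.4** wedge condition (2.2) ↦ ⟨CARRIER⟩ `IsWedge`, `Sec2Core.Obj`; «for `n ≤ 2` follows from the signature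
condition» ↦ `Def24_wedge_of_le_two`; (2.3) `M[Δ⁻¹] = M^naive[Δ⁻¹]` ↦ `Def24_awayFromDisc`; **Thm. 2.5** (Pappas) ↦ `Thm25`
(recorded token); **Not. 2.6** `M = M(n−r,r) ×_{Spec O_k} M₀` ↦ `MObj`.
§2.2 (p. 9): `V'(A,E) = Hom_{O_k}(E,A)` ↦ `HomOK` (REAL); `h'` (2.4) ↦ ⟨CARRIER⟩ `hermForm`, its hermitian-ness ↦
`hermForm_isHermitian`; **Lem. 2.7** ↦ `Lemma27`; **Def. 2.8** `Z(T)` (2.5) ↦ `ZObj`; **Prop. 2.9** ↦ `Prop29` (REAL finiteness of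
`{x ∣ h'(x,x) = T}` + recorded tokens).
§2.3 (p. 10): `V'_{𝔸_f^p}`, `h'`, `h = h_λ` (2.6) ↦ ⟨CARRIER⟩ `TateHom`, `tateEmb`, `tateForm'`, `tateFormWeil`; «the natural embedding
is isometric» ↦ `tateEmb_isometric`; **Lem. 2.10** ↦ `Lemma210`.
§2.4 (pp. 10–14): relevant hermitian spaces `R_{(n−r,r)}(k)` ↦ `SelfDualLattice`, `IsRelevant`, `HermIso`, `HermStrictSim`;
**Lem. 2.11** ↦ `Lemma211_i`, `Lemma211_ii`; **Prop. 2.12** ↦ `Prop212_i`, `Prop212_ii` (⟨CARRIER⟩ labels `Sec2Data.labelSharp` / `label` =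
`(V(ξ), [[L]])` / `V(ξ)`, `Sec2Data.pairLabel` = `Hom_k(V(ξ₀), V(ξ))`, on objects); **Rem. 2.13** (for `n` odd (i) is trivial) — a consequence of `Lemma211_ii`, not typed; the
`G₁^V`-genus `[[L]]` ↦ ⟨CARRIER⟩ `SameGenus`; **Prop. 2.14** (Jacobowitz) ↦ `Prop214` (special case `V_p = V ⊗ ℚ_p` of a global
`V` — TODO(general form): an arbitrary local hermitian space over `k_p/ℚ_p`); **Rem. 2.15** (i) explicit orbit representatives —
not typed (examples), (ii) «type I / type II» ↦ `IsTypeII` (REAL), (iii) Jacobowitz Prop. 10.4 — provenance, not typed; **Cor.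
2.16** ↦ `Cor216`; `G^V(𝔸_f)^0` ↦ ⟨CARRIER⟩ `SameGenus0`; **Lem. 2.17** ↦ `Lemma217`; **Def. 2.18** `R^♯` ↦ `RelevantSharp`,
`RelevantSharp.Iso`, «the genus is determined by its type» ↦ `Def218_genus_of_type`, «`n` odd or `2` unramified ⇒ type I and
`R^♯ → R` bijective» ↦ `Def218_typeI`; `M(n−r,r)[½]`, `M[½]` ↦ `IsAwayFromTwo`; **Prop. 2.19** ↦ `Sec2Data.Prop219` (on `labelSharp`, with `RelevantSharp.StrictSim` / `RelevantSharp.Iso`).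
§2.5 (pp. 14–15): **Lem. 2.20** ↦ `Lemma220`; **Lem. 2.21** ↦ `Lemma221` (⟨CARRIER⟩ `IsSupersingular`); `Diff₀(T)` ↦ `diff0`
(REAL); **Prop. 2.22** ↦ `Prop222_i`, `Sec2Data.Prop222_ii`, `Sec2Data.Prop222_iii` (⟨CARRIER⟩ local invariants `locInv`, `locInvMat`).

READINGS (the only interpretive choices): R1 «`S` a locally noetherian `O_k`-scheme» = a scheme `S` with a morphism
`f : S → Spec O_k`, `[IsLocallyNoetherian S]` where the print uses it; R2 «principal polarization» = ★ `Polarization` whose `λ` is an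
isomorphism `A ≅ A^∨` (`IsIso pol.lam`); R3 `Hom_{O_k}(E, A)` = homomorphisms of `S`-group schemes commuting with the actions
(`HomOK`), its zero is the unit `1` of the (multiplicatively written) group `Hom_S(E, A)`; R4 «positive-definite» `O_k`-valued
hermitian form = `h'(x,x) ∈ ℤ_{>0}` for `x ≠ 0`; R5 «disjoint decomposition of algebraic stacks `M = ∐_V M^V`» = a labelling of
objects by `R_{(n−r,r)}(k)` (resp. its strict-similarity classes) invariant under isomorphisms and, over a CONNECTED locally
noetherian base, equal to the label of every field-valued point (open-and-closed summands), as in `Sec3IntegralModels.Lemma34`;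
R6 `T ∈ Herm_m(O_k)_{>0}` = `IsPosDefHerm T`; R7 «supp Z(T) ⊂ X» ON GEOMETRIC POINTS: every point of `Z(T)` with values in an
algebraically closed field lies in `X`; R8 counting statements «the number of … is N» = a family of `N` pairwise inequivalent
representatives meeting every class; R9 «p inert» = `(p)` prime in `O_k` and `p ∤ Δ`, «p ramified» = `p ∣ Δ`, `Δ = NumberField.discr k`; R10 statements about objects
«over `S`» whose print presupposes a connected base (§2.2 «When `S` is connected», proof of Prop. 2.12 «for a connected base `S`»)
carry `[ConnectedSpace S]` (in particular `S ≠ ∅`: over the empty scheme every moduli problem has its empty object and the labels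
are junk).

## NOT here
§1 Introduction (Thm. 1.1 = INDEX to §§11–12, squad file `Sec1Introduction`), §3 ff.; the construction of `V(ξ)` from `H₁(A_ℂ, ℚ)` /
Tate modules (proof of Prop. 2.12) beyond the ⟨CARRIER⟩ label; DM stacks; proofs.

## References
* [KudlaRapoport2013] S. Kudla, M. Rapoport, *Special cycles on unitary Shimura varieties II: global theory*, J. reine angew. Math.
  697 (2014) 91–157 = arXiv:0912.3758v2, §2 pp. 7–15 (Prop. 2.1 p. 8, Ex. 2.2 p. 8, Rem. 2.3 p. 8, Def. 2.4 p. 8, Thm. 2.5 p. 8,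
  Not. 2.6 p. 9, Lem. 2.7 p. 9, Def. 2.8 p. 9, Prop. 2.9 p. 9, Lem. 2.10 p. 10, Lem. 2.11 pp. 10–11, Prop. 2.12 p. 11, Rem. 2.13 p. 11,
  Prop. 2.14 p. 12, Rem. 2.15 p. 13, Cor. 2.16 p. 13, Lem. 2.17 p. 13, Def. 2.18 p. 13, Prop. 2.19 p. 14, Lem. 2.20 p. 14, Lem. 2.21
  p. 14, Prop. 2.22 p. 15).
* [Liu2021] Y. Liu, *Fourier–Jacobi cycles and arithmetic relative trace formula*, App. C (the tree's `HermSpace`, `conj`).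
* [Kottwitz1992] R. Kottwitz, *Points on some Shimura varieties over finite fields*, JAMS 5 (1992) §5 (the determinant condition; ★
  `RingAction`, `lieCharpoly`).
-/

noncomputable section

open NumberField CategoryTheory CategoryTheory.Limits AlgebraicGeometry MonoidalCategory CartesianMonoidalCategory
open scoped MonObj
open Literature.AlgebraicGeometry.AbelianSchemes (AbelianSchemeOver)
open Literature.NumberTheory.Automorphic.Liu2021.AppendixC (HermSpace conj)
open Literature.AlgebraicGeometry.ShimuraVarieties.KudlaRapoport2013.Sec2Defs
open Literature.AlgebraicGeometry.ShimuraVarieties.KudlaRapoport2013.Sec2Defs.Sec2Core (HomOK IsAwayFromTwo)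

namespace Literature.AlgebraicGeometry.ShimuraVarieties.KudlaRapoport2013.Sec2GlobalModuliProblem

variable {k : Type} [Field k] [NumberField k] [IsTotallyComplex k] [Algebra.IsQuadraticExtension ℚ k]

section Core

variable (C : Sec2Core k)

/-! ### §2.1 (pp. 7–9): (2.1), Prop. 2.1, Ex. 2.2, the conjugation isomorphism, Rem. 2.3, Def. 2.4 with (2.3), Thm. 2.5 -/

/-- **«In particular, `A` is of relative dimension `n` over `S`»** (p. 8, from the signature condition (2.1) of degree `n`): every
`(A, ι)` satisfying the ⟨CARRIER⟩ signature condition of type `(a, b)` has `A → S` smooth of relative dimension `a + b`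
(★ `AbelianSchemeOver.IsOfRelDim`). [cite: KudlaRapoport2013, §2.1 (arXiv v2 p. 8)] -/
def relDim_of_signature : Prop :=
  ∀ {S : Scheme.{0}} (f : S ⟶ Spec (.of (𝓞 k))) (A : AbelianSchemeOver S) (ιA : A.RingAction (𝓞 k)) (a b : ℕ),
    C.IsSignature f A ιA a b → A.IsOfRelDim (a + b)

/-- **[KR2013, Proposition 2.1]** (p. 8): «`M(n−r,r)^naive` is a Deligne–Mumford stack over `Spec O_k`. Furthermore,
`M(n−r,r)^naive ×_{Spec O_k} Spec O_k[Δ⁻¹]` is smooth of relative dimension `(n−r)r` over `Spec O_k[Δ⁻¹]`.» (proof: representability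
of the stack of principally polarized abelian varieties + Hilbert schemes; infinitesimal criterion + Grothendieck–Messing.)  TYPED as
the conjunction of the recorded ⟨TOKEN⟩s (1) and (2) at `d = (n−r)r` — DELIBERATELY WEAKER than print (no stack vocabulary; see
`StackSentences`). (= v1 Prop. 2.1.) [cite: KudlaRapoport2013, §2.1 Proposition 2.1 (arXiv v2 p. 8)] -/
def Prop21 : Prop :=
  C.stack.naiveIsDMStack ∧ C.stack.naiveSmoothAwayFromDisc ((C.n - C.r) * C.r)

/-- **[KR2013, Example 2.2], «In this case, the polarization `λ₀` is uniquely determined»** (p. 8): any other principal polarization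
of `(E, ι₀)` on the same dual pair satisfying the Rosati condition is the pull-back of `λ₀` under the identity.  (Recorded, not typed —
no coarse-moduli vocabulary: «The coarse moduli space of `M(1,0)^naive` is `Spec O_H` where `H` is the Hilbert class field of `k`».)
(= v1 Ex. 2.3.) [cite: KudlaRapoport2013, §2.1 Example 2.2 (arXiv v2 p. 8)] -/
def Ex22_polarizationUnique : Prop :=
  ∀ {S : Scheme.{0}} (f : S ⟶ Spec (.of (𝓞 k))) (x : C.M0Obj f) (pol' : x.E.Polarization x.D₀),
    IsIso pol'.lam → C.RosatiIsConj x.E x.D₀ pol' x.ι₀ → C.PolPullback (Iso.refl x.E.X) x.pol₀ pol'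

/-- **[KR2013, Example 2.2], «Note that `End_{O_k}(E/S, ι₀) = O_k` for any `(E, ι₀, λ₀) ∈ M(1,0)^naive(S)`»** (p. 8): every
endomorphism of the `S`-group scheme `E` commuting with the `O_k`-action is `ι₀(a)` for a unique `a ∈ O_k` (`S` connected, in
particular non-empty, as throughout §2.2). (= v1 Ex. 2.3.)
[cite: KudlaRapoport2013, §2.1 Example 2.2 (arXiv v2 p. 8)] -/
def Ex22_endomorphisms : Prop :=
  ∀ {S : Scheme.{0}} [ConnectedSpace S] (f : S ⟶ Spec (.of (𝓞 k))) (x : C.M0Obj f) (v : x.E.X ⟶ x.E.X),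
    IsMonHom v → (∀ a : 𝓞 k, v ≫ x.ι₀.i a = x.ι₀.i a ≫ v) → ∃! a : 𝓞 k, v = x.ι₀.i a

/-- **The conjugation isomorphism** (p. 8, after Ex. 2.2): «there is a natural isomorphism between the moduli stacks `M(n−r,r)^naive`
and `M(r,n−r)^naive` which associates to `(A, ι, λ)` its conjugate `(A, ῑ, λ)`, where the `O_k`-action on `A` has been changed to its
conjugate, i.e., `ῑ(a) = ι(a^σ)`.»  TYPED on objects (the functor is the identity on `A`, `λ` and on morphisms): for `ῑ = ι ∘ σ`,
`(A, ι)` has signature type `(a, b)` iff `(A, ῑ)` has type `(b, a)`, and the Rosati condition for `(λ, ι)` is that for `(λ, ῑ)`.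
(= v1, after Ex. 2.3; cf. ★ `EndomorphismFieldSignatureConjugateTwist`.) [cite: KudlaRapoport2013, §2.1 after Example 2.2 (arXiv v2 p. 8)] -/
def conjugationIso : Prop :=
  ∀ {S : Scheme.{0}} (f : S ⟶ Spec (.of (𝓞 k))) (A : AbelianSchemeOver S) (ιA ιB : A.RingAction (𝓞 k)),
    (∀ a : 𝓞 k, ιB.i a = ιA.i (sigmaInt k a)) →
      (∀ a b : ℕ, C.IsSignature f A ιA a b ↔ C.IsSignature f A ιB b a) ∧
        ∀ (Dp : A.DualPair) (pol : A.Polarization Dp), C.RosatiIsConj A Dp pol ιA ↔ C.RosatiIsConj A Dp pol ιB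

/-- **[KR2013, Remark 2.3]** (p. 8): «As was first pointed out by Pappas, `M(n−r,r)^naive` is not flat over `Spec O_k` for `n ≥ 3`.»
TYPED as the negation of the recorded ⟨TOKEN⟩ (3) under `3 ≤ n` (DELIBERATELY WEAKER than print: token). (= v1 Rem. 2.4.)
[cite: KudlaRapoport2013, §2.1 Remark 2.3 (arXiv v2 p. 8)] -/
def Rem23 : Prop :=
  3 ≤ C.n → ¬ C.stack.naiveIsFlat

/-- **[KR2013, Definition 2.4], «For `n ≤ 2`, this condition follows from the signature condition»** (p. 8): for `n ≤ 2` the wedge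
condition (2.2) of type `(n−r, r)` is implied by the signature condition (2.1) of the same type. (= v1 Def. 2.5.)
[cite: KudlaRapoport2013, §2.1 Definition 2.4 (arXiv v2 p. 8)] -/
def Def24_wedge_of_le_two : Prop :=
  C.n ≤ 2 → ∀ {S : Scheme.{0}} (f : S ⟶ Spec (.of (𝓞 k))) (A : AbelianSchemeOver S) (ιA : A.RingAction (𝓞 k)),
    C.IsSignature f A ιA (C.n - C.r) C.r → C.IsWedge f A ιA (C.n - C.r) C.r

/-- **[KR2013, Definition 2.4, (2.3)]** (p. 8): «Furthermore, over `Spec O_k[Δ⁻¹]`, `M(n−r,r)[Δ⁻¹] = M(n−r,r)^naive[Δ⁻¹]`» — over a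
base `S → Spec O_k[Δ⁻¹] → Spec O_k` (`O_k[Δ⁻¹]` = Mathlib `Localization.Away (Δ : O_k)`) every object of `M(n−r,r)^naive(S)` satisfies the
wedge condition. (= v1 (2.3) of Def. 2.5.) [cite: KudlaRapoport2013, §2.1 Definition 2.4 (2.3) (arXiv v2 p. 8)] -/
def Def24_awayFromDisc : Prop :=
  ∀ {S : Scheme.{0}} (g : S ⟶ Spec (.of (Localization.Away ((NumberField.discr k : ℤ) : 𝓞 k))))
    (x : C.NaiveObj (g ≫ Spec.map (CommRingCat.ofHom (algebraMap (𝓞 k) (Localization.Away ((NumberField.discr k : ℤ) : 𝓞 k)))))),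
    C.IsWedge (g ≫ Spec.map (CommRingCat.ofHom (algebraMap (𝓞 k) (Localization.Away ((NumberField.discr k : ℤ) : 𝓞 k)))))
      x.A x.ιA (C.n - C.r) C.r

/-- **[KR2013, Theorem 2.5] (Pappas)** (p. 8): «Let `r = 1`, and assume `2 ∤ Δ`. Then the stack `M(n−1,1)` is flat over `Spec O_k`.»
(proof: [Pappas, JAG 9 (2000)] Thm. 4.5 a).)  TYPED: under `r = 1` and `Δ` odd, the recorded ⟨TOKEN⟩ (4) (DELIBERATELY WEAKER than
print: token). (= v1 Thm. 2.6.) [cite: KudlaRapoport2013, §2.1 Theorem 2.5 (arXiv v2 p. 8)] -/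
def Thm25 : Prop :=
  C.r = 1 → ¬ 2 ∣ (NumberField.discr k).natAbs → C.stack.isFlat

/-! ### §2.2 (p. 9): the hermitian form `h'` (2.4), Lemma 2.7, Proposition 2.9 -/

/-- **«On this `O_k`-module there is a `O_k`-valued hermitian form given by (2.4)»** (p. 9): for `(E, ι₀, λ₀) ∈ M₀(S)`,
`(A, ι, λ) ∈ M(n−r,r)(S)`, `S` connected, the ⟨CARRIER⟩ `h'` restricted to `Hom_{O_k}(E, A)` is additive in the first variable
(the group law of `Hom_S(E, A)` is written multiplicatively, READING R3), `O_k`-linear in the first variable for `a · x = ι(a) ∘ x`,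
and hermitian: `h'(y, x) = h'(x, y)^σ`. [cite: KudlaRapoport2013, §2.2 (2.4) (arXiv v2 p. 9)] -/
def hermForm_isHermitian : Prop :=
  ∀ {S : Scheme.{0}} [ConnectedSpace S] (f : S ⟶ Spec (.of (𝓞 k))) (e : C.M0Obj f) (x : C.Obj f)
    (u v w : HomOK e.ι₀ x.ιA),
    C.hermForm e.ι₀ x.ιA e.pol₀ x.pol (u.1 * v.1) w.1 =
        C.hermForm e.ι₀ x.ιA e.pol₀ x.pol u.1 w.1 + C.hermForm e.ι₀ x.ιA e.pol₀ x.pol v.1 w.1 ∧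
    (∀ a : 𝓞 k, C.hermForm e.ι₀ x.ιA e.pol₀ x.pol (u.1 ≫ x.ιA.i a) w.1 = a * C.hermForm e.ι₀ x.ιA e.pol₀ x.pol u.1 w.1) ∧
    C.hermForm e.ι₀ x.ιA e.pol₀ x.pol w.1 u.1 = sigmaInt k (C.hermForm e.ι₀ x.ιA e.pol₀ x.pol u.1 w.1)

/-- **[KR2013, Lemma 2.7]** (p. 9): «The hermitian form `h'` on `V'(A, E)` is positive-definite.» — READING R4: for `S` connected,
`(E, ι₀, λ₀) ∈ M₀(S)`, `(A, ι, λ) ∈ M(n−r,r)(S)` and `x ∈ Hom_{O_k}(E, A)` non-zero (`≠ 1` in the multiplicatively written group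
`Hom_S(E, A)`), `h'(x, x)` is a positive rational integer. (= v1 Lem. 2.8; proof: positivity of the Rosati involution on `E × A`.)
[cite: KudlaRapoport2013, §2.2 Lemma 2.7 (arXiv v2 p. 9)] -/
def Lemma27 : Prop :=
  ∀ {S : Scheme.{0}} [ConnectedSpace S] (f : S ⟶ Spec (.of (𝓞 k))) (e : C.M0Obj f) (x : C.Obj f) (u : HomOK e.ι₀ x.ιA),
    u.1 ≠ 1 → ∃ m : ℕ, 0 < m ∧ C.hermForm e.ι₀ x.ιA e.pol₀ x.pol u.1 u.1 = m

/-- **[KR2013, Proposition 2.9]** (p. 9): «`Z(T)` is representable by a DM-stack. The natural morphism `Z(T) → M` is finite and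
unramified.»  TYPED: the REAL finiteness its proof rests on — «by the positive definiteness of `h'`, the set
`{x ∈ Hom_{O_k}(E, A)^m ∣ h'(x, x) = T}` is finite» for every `S`-point of `M`, `S` connected (the fibre of `Z(T)(S) → M(S)`) — in
conjunction with the recorded ⟨TOKEN⟩s (5), (6) (DELIBERATELY WEAKER than print there). (= v1 Prop. 2.10.)
[cite: KudlaRapoport2013, §2.2 Proposition 2.9 (arXiv v2 p. 9)] -/
def Prop29 : Prop :=
  (∀ {S : Scheme.{0}} [ConnectedSpace S] (f : S ⟶ Spec (.of (𝓞 k))) (y : C.MObj f) {m : ℕ} (T : Matrix (Fin m) (Fin m) (𝓞 k)),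
      1 ≤ m → Set.Finite {x : Fin m → HomOK y.pt₀.ι₀ y.pt.ιA |
        ∀ i j : Fin m, C.hermForm y.pt₀.ι₀ y.pt.ιA y.pt₀.pol₀ y.pt.pol (x i).1 (x j).1 = T i j}) ∧
    ∀ {m : ℕ} (T : Matrix (Fin m) (Fin m) (𝓞 k)), 1 ≤ m → C.stack.cycleIsDMStack T ∧ C.stack.cycleToMFiniteUnramified T

/-! ### §2.3 (p. 10): the Tate-module variant and Lemma 2.10 (⟨CARRIER⟩ forms; typed at field points) -/

/-- **«Then the natural embedding `V'(A, E) → V'_{𝔸_f^p}` is isometric»** (§2.3 p. 10), for a point `(A, ι, λ; E, ι₀, λ₀) ∈ M(F)` over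
an algebraically closed field `F` of characteristic `p`: `h'(tateEmb x, tateEmb y) = h'(x, y)` read in `k ⊗ 𝔸_f^p`.
[cite: KudlaRapoport2013, §2.3 (arXiv v2 p. 10)] -/
def tateEmb_isometric : Prop :=
  ∀ (p : ℕ) {F : Type} [Field F] [IsAlgClosed F] [CharP F p] (f : Spec (.of F) ⟶ Spec (.of (𝓞 k))) (y : C.MObj f)
    (u v : HomOK y.pt₀.ι₀ y.pt.ιA),
    C.tateForm' p y.pt₀.ι₀ y.pt.ιA y.pt₀.pol₀ y.pt.pol (C.tateEmb p y.pt₀.ι₀ y.pt.ιA u.1) (C.tateEmb p y.pt₀.ι₀ y.pt.ιA v.1) =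
      C.tateCoeffMap p (C.hermForm y.pt₀.ι₀ y.pt.ιA y.pt₀.pol₀ y.pt.pol u.1 v.1)

/-- **[KR2013, Lemma 2.10]** (p. 10): «The two hermitian forms `h'( , )` and `h( , )` on `Hom_{k ⊗ 𝔸_f^p}(T^p(E)^0, T^p(A)^0)` are
identical.» — for every point of `M` over an algebraically closed field of characteristic `p`, on the ⟨CARRIER⟩ `TateHom`.
(= v1 Lem. 2.11.) [cite: KudlaRapoport2013, §2.3 Lemma 2.10 (arXiv v2 p. 10)] -/
def Lemma210 : Prop :=
  ∀ (p : ℕ) {F : Type} [Field F] [IsAlgClosed F] [CharP F p] (f : Spec (.of F) ⟶ Spec (.of (𝓞 k))) (y : C.MObj f)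
    (s t : C.TateHom p y.pt₀.ι₀ y.pt.ιA),
    C.tateForm' p y.pt₀.ι₀ y.pt.ιA y.pt₀.pol₀ y.pt.pol s t = C.tateFormWeil p y.pt₀.ι₀ y.pt.ιA y.pt₀.pol₀ y.pt.pol s t

/-! ### §2.4 (pp. 10–14): Lemma 2.11, Proposition 2.14, Corollary 2.16, Lemma 2.17, Definition 2.18 (its two sentences) -/

/-- **[KR2013, Lemma 2.11 (i)]** (pp. 10–11): «The cardinality of `R_{(n−r,r)}(k)` is `|R_{(n−r,r)}(k)| = 2^{δ−1}`, where `δ` is the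
number of primes that ramify in `k`» — READING R8: there are `2^{δ−1}` pairwise non-isometric relevant spaces meeting every
isometry class of relevant spaces. (= v1 Lem. 2.12 (i); proof: Hasse principle, `inv_∞(V) = (−1)^r = ∏_{p ∣ Δ} inv_p(V)`.)
[cite: KudlaRapoport2013, §2.4 Lemma 2.11 (i) (arXiv v2 pp. 10–11)] -/
def Lemma211_i : Prop :=
  ∃ (N : ℕ) (v : Fin N → HermSpace ℚ k),
    (∀ i, C.IsRelevant (v i)) ∧ (∀ i j, HermIso k (v i) (v j) → i = j) ∧
      (∀ V : HermSpace ℚ k, C.IsRelevant V → ∃ i, HermIso k V (v i)) ∧ N = 2 ^ (numRamifiedPrimes k - 1)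

/-- **[KR2013, Lemma 2.11 (ii)]** (p. 11): «The number of strict similarity classes of relevant hermitian spaces is
`|R_{(n−r,r)}(k)/str.sim.| = 2^{δ−1}` if `n` is even, `1` if `n` is odd.» (READING R8.) (= v1 Lem. 2.12 (ii).)
[cite: KudlaRapoport2013, §2.4 Lemma 2.11 (ii) (arXiv v2 p. 11)] -/
def Lemma211_ii : Prop :=
  ∃ (N : ℕ) (v : Fin N → HermSpace ℚ k),
    (∀ i, C.IsRelevant (v i)) ∧ (∀ i j, HermStrictSim k (v i) (v j) → i = j) ∧
      (∀ V : HermSpace ℚ k, C.IsRelevant V → ∃ i, HermStrictSim k V (v i)) ∧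
        (Even C.n → N = 2 ^ (numRamifiedPrimes k - 1)) ∧ (Odd C.n → N = 1)

/-- **[KR2013, Proposition 2.14] (Jacobowitz)** (p. 12): «Suppose that `V_p` is a non-degenerate hermitian space of dimension `n` over
`k_p/ℚ_p` and that `V_p` contains a self-dual lattice. Then the unitary group `U(V_p)` acts transitively on the set of self-dual
lattices in `V_p` except in the following cases: (a) … (b) … Then there are two `U(V_p)`-orbits of self-dual lattices in `V_p`.»
TYPED for the localizations `V_p` of a hermitian space `V` over `k` on the ⟨CARRIER⟩ local lattices / orbits (READING R8 for «two
orbits»).  -- TODO(general form): an arbitrary local hermitian space over `k_p/ℚ_p`, not necessarily a localization.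
(= v1 Prop. 2.15; [Jacobowitz 1962] §§9–10.) [cite: KudlaRapoport2013, §2.4 Proposition 2.14 (arXiv v2 p. 12)] -/
def Prop214 : Prop :=
  ∀ (V : HermSpace ℚ k) (p : ℕ), p.Prime → Nonempty (C.LocSelfDual V p) →
    ((¬ C.IsCaseA V p ∧ ¬ C.IsCaseB V p) → ∀ L L' : C.LocSelfDual V p, C.locSameOrbit L L') ∧
    ((C.IsCaseA V p ∨ C.IsCaseB V p) →
      ∃ L₁ L₂ : C.LocSelfDual V p, ¬ C.locSameOrbit L₁ L₂ ∧ ∀ L : C.LocSelfDual V p, C.locSameOrbit L L₁ ∨ C.locSameOrbit L L₂)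

/-- **[KR2013, Corollary 2.16]** (p. 13): «For a relevant hermitian space `V` in `R_{(n−r,r)}(k)`, the number of `G₁^V`-genera of
self-dual lattices in `V` is `2` or `1` depending on whether or not one of the exceptional cases (a) and (b) occurs at the prime
`p = 2`.» (READING R8, ⟨CARRIER⟩ `SameGenus`.) (= v1 Cor. 2.17.) [cite: KudlaRapoport2013, §2.4 Corollary 2.16 (arXiv v2 p. 13)] -/
def Cor216 : Prop :=
  ∀ V : HermSpace ℚ k, C.IsRelevant V →
    ∃ (N : ℕ) (L : Fin N → SelfDualLattice k V),
      (∀ i j, C.SameGenus (L i) (L j) → i = j) ∧ (∀ L' : SelfDualLattice k V, ∃ i, C.SameGenus L' (L i)) ∧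
        ((C.IsCaseA V 2 ∨ C.IsCaseB V 2) → N = 2) ∧ (¬ (C.IsCaseA V 2 ∨ C.IsCaseB V 2) → N = 1)

/-- **[KR2013, Lemma 2.17]** (p. 13): «Let `G^V(𝔸_f)^0 = {g ∈ G^V(𝔸_f) ∣ ν(g) ∈ Ẑ^×}`. Then the orbit of a self-dual lattice under the
action of `G^V(𝔸_f)^0` is the same as the orbit under `G₁^V(𝔸_f)`.» (for a relevant `V`, the standing hypothesis of p. 12; ⟨CARRIER⟩ orbit
relations.) (= v1 Lem. 2.18.) [cite: KudlaRapoport2013, §2.4 Lemma 2.17 (arXiv v2 p. 13)] -/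
def Lemma217 : Prop :=
  ∀ (V : HermSpace ℚ k) (L L' : SelfDualLattice k V), C.IsRelevant V → (C.SameGenus0 L L' ↔ C.SameGenus L L')

/-- **[KR2013, Definition 2.18], «The `G₁^V`-genus is determined by its type, as defined in (ii) of the preceding remark»** (p. 13):
two self-dual lattices of a relevant `V` of the same type (both type II or both type I) lie in the same genus. (= v1 Def. 2.19.)
[cite: KudlaRapoport2013, §2.4 Definition 2.18 (arXiv v2 p. 13)] -/
def Def218_genus_of_type : Prop :=
  ∀ (V : HermSpace ℚ k) (L L' : SelfDualLattice k V), C.IsRelevant V → (IsTypeII k L ↔ IsTypeII k L') → C.SameGenus L L'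

/-- **[KR2013, Definition 2.18], «Of course, if `n` is odd or if `n` is even and `2` is unramified in `k`, all self-dual lattices are
of type I and the natural map from `R_{(n−r,r)}(k)^♯` to `R_{(n−r,r)}(k)` is a bijection»** (p. 13): REAL first clause; the second =
any two self-dual lattices of a relevant `V` lie in one genus. (= v1 Def. 2.19.) [cite: KudlaRapoport2013, §2.4 Definition 2.18 (arXiv v2 p. 13)] -/
def Def218_typeI : Prop :=
  (Odd C.n ∨ (Even C.n ∧ ¬ 2 ∣ (NumberField.discr k).natAbs)) →
    ∀ V : HermSpace ℚ k, C.IsRelevant V →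
      (∀ L : SelfDualLattice k V, ¬ IsTypeII k L) ∧ ∀ L L' : SelfDualLattice k V, C.SameGenus L L'

/-! ### §2.5 (pp. 14–15): Lemma 2.20, Lemma 2.21, Proposition 2.22 (i) -/

/-- **[KR2013, Lemma 2.20]** (p. 14): «If `T ∈ Herm_m(O_k)_{>0}` for `m > n−r`, then `Z(T)_ℚ = ∅`.» — on field points of characteristic
`0` (READING R7: the generic fibre has no point with values in any field of characteristic zero). (= v1 Lem. 2.21; proof: Cor. 3.6.)
[cite: KudlaRapoport2013, §2.5 Lemma 2.20 (arXiv v2 p. 14)] -/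
def Lemma220 : Prop :=
  ∀ {m : ℕ} (T : Matrix (Fin m) (Fin m) (𝓞 k)), IsPosDefHerm k T → C.n - C.r < m →
    ∀ (F : Type) [Field F] [CharZero F] (f : Spec (.of F) ⟶ Spec (.of (𝓞 k))), IsEmpty (C.ZObj f T)

/-- **[KR2013, Lemma 2.21]** (p. 14): «Let `0 < r < n`. Let `T ∈ Herm_n(O_k)_{>0}`. Then `supp(Z(T))` is contained in the union over
finitely many inert or ramified `p` of the supersingular locus of `M_p`.» — READING R7: there is a finite set `P` of primes, each inert
or ramified in `k`, such that every geometric point of `Z(T)` has residue characteristic in `P` and supersingular `A` (⟨CARRIER⟩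
`IsSupersingular`). (= v1 Lem. 2.22.) [cite: KudlaRapoport2013, §2.5 Lemma 2.21 (arXiv v2 p. 14)] -/
def Lemma221 : Prop :=
  0 < C.r → C.r < C.n → ∀ (T : Matrix (Fin C.n) (Fin C.n) (𝓞 k)), IsPosDefHerm k T →
    ∃ P : Finset ℕ, (∀ p ∈ P, IsInertPrime k p ∨ IsRamifiedPrime k p) ∧
      ∀ (F : Type) [Field F] [IsAlgClosed F] (f : Spec (.of F) ⟶ Spec (.of (𝓞 k))) (z : C.ZObj f T),
        ringChar F ∈ P ∧ C.IsSupersingular z.pt.A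

/-- **[KR2013, Proposition 2.22 (i)]** (p. 15; `r = 1`, `T ∈ Herm_n(O_k)_{>0}`): «If `|Diff₀(T)| > 1`, then `Z(T)` is empty.» — READING
R7: no geometric point (no point with values in an algebraically closed field; over the empty base every stack has its empty object,
so «empty» is read on geometric points). (= v1 Prop. 2.23 (i).) [cite: KudlaRapoport2013, §2.5 Proposition 2.22 (i) (arXiv v2 p. 15)] -/
def Prop222_i : Prop :=
  C.r = 1 → ∀ (T : Matrix (Fin C.n) (Fin C.n) (𝓞 k)), IsPosDefHerm k T →
    (∃ p ∈ diff0 k T, ∃ q ∈ diff0 k T, p ≠ q) →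
      ∀ (F : Type) [Field F] [IsAlgClosed F] (f : Spec (.of F) ⟶ Spec (.of (𝓞 k))), IsEmpty (C.ZObj f T)

end Core

section Labels

variable {C : Sec2Core k} (D : C.Sec2Data)

/-! ### §2.4 (pp. 11, 14): Proposition 2.12, Proposition 2.19 (the decompositions, on the labels of `Sec2Data`) -/

/-- **[KR2013, Proposition 2.12 (i)]** (p. 11): «There is a natural disjoint decomposition of algebraic stacks
`M(n−r,r) = ∐_{V ∈ R_{(n−r,r)}(k)/str.sim.} M(n−r,r)^V`» — READING R5 on the ⟨CARRIER⟩ label `V(ξ) ∈ R_{(n−r,r)}(k)` (relevant by the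
type of `labelSharp`): over a locally noetherian base, (b) isomorphic objects have strictly similar labels; (c) over a CONNECTED base
the label of the base change to every field-valued point is strictly similar to the label. (= v1 Prop. 2.13 (i).)
[cite: KudlaRapoport2013, §2.4 Proposition 2.12 (i) (arXiv v2 p. 11)] -/
def Prop212_i : Prop :=
  (∀ {S : Scheme.{0}} [IsLocallyNoetherian S] [ConnectedSpace S] (f : S ⟶ Spec (.of (𝓞 k))) (x y : C.Obj f),
      x.toNaiveObj.Iso y.toNaiveObj → HermStrictSim k (D.label f x) (D.label f y)) ∧
  (∀ {S : Scheme.{0}} [IsLocallyNoetherian S] [ConnectedSpace S] (f : S ⟶ Spec (.of (𝓞 k))) (x : C.Obj f)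
      (F : Type) [Field F] (s : Spec (.of F) ⟶ S),
      HermStrictSim k (D.label (s ≫ f) (x.baseChange s)) (D.label f x))

/-- **[KR2013, Proposition 2.12 (ii)]** (p. 11): «There is a natural disjoint decomposition of algebraic stacks
`M = M(n−r,r) ×_{Spec O_k} M₀ = ∐_{V ∈ R_{(n−r,r)}(k)} M^V`. For `n` even, this decomposition is obtained by base change from that in
(i).» — READING R5 on the ⟨CARRIER⟩ `pairLabel` = «`V = Hom_k(V(ξ₀), V(ξ)) ∈ R_{(n−r,r)}(k)`, independent of all choices» (p. 12):
(a) relevant; (b) invariant under isomorphisms of pairs up to ISOMETRY; (c) constant up to isometry along field-valued points of a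
connected base; (d) «for `n` even … by base change from (i)»: the pair label is strictly similar to `V(ξ)` (for `n` even strict
similarity classes are isometry classes, Lemma 2.11 (ii)). (= v1 Prop. 2.13 (ii).) [cite: KudlaRapoport2013, §2.4 Proposition 2.12 (ii) (arXiv v2 p. 11)] -/
def Prop212_ii : Prop :=
  (∀ {S : Scheme.{0}} [IsLocallyNoetherian S] [ConnectedSpace S] (f : S ⟶ Spec (.of (𝓞 k))) (y : C.MObj f),
      C.IsRelevant (D.pairLabel f y)) ∧
  (∀ {S : Scheme.{0}} [IsLocallyNoetherian S] [ConnectedSpace S] (f : S ⟶ Spec (.of (𝓞 k))) (y z : C.MObj f),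
      y.pt.toNaiveObj.Iso z.pt.toNaiveObj → y.pt₀.Iso z.pt₀ → HermIso k (D.pairLabel f y) (D.pairLabel f z)) ∧
  (∀ {S : Scheme.{0}} [IsLocallyNoetherian S] [ConnectedSpace S] (f : S ⟶ Spec (.of (𝓞 k))) (y : C.MObj f)
      (F : Type) [Field F] (s : Spec (.of F) ⟶ S),
      HermIso k (D.pairLabel (s ≫ f) (y.baseChange s)) (D.pairLabel f y)) ∧
  (Even C.n → ∀ {S : Scheme.{0}} [IsLocallyNoetherian S] [ConnectedSpace S] (f : S ⟶ Spec (.of (𝓞 k))) (y : C.MObj f),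
      HermStrictSim k (D.pairLabel f y) (D.label f y.pt))

/-- **[KR2013, Proposition 2.19]** (p. 14): «(i) There is a natural disjoint decomposition of algebraic stacks
`M(n−r,r)[½] = ∐_{V^♯ ∈ R_{(n−r,r)}(k)^♯/str.sim.} M(n−r,r)[½]^{V^♯}`. (ii) There is a natural disjoint decomposition of algebraic
stacks `M[½] = ∐_{V^♯ ∈ R_{(n−r,r)}(k)^♯} M[½]^{V^♯}`. For `n` even, this decomposition is obtained by base change from that in (i).»
TYPED (READING R5) on the ⟨CARRIER⟩ `labelSharp = (V(ξ), [[L]])` over bases away from `2`: (i) isomorphic objects have strictly similar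
labels in `R^♯`, and over a connected base the label is constant along field-valued points up to strict similarity in `R^♯` («the type
of the genus of self-dual lattices in `V` determined by `T^p(A)` is well defined», proof p. 14); (ii) for `S`-points of `M` the same
with ISOMORPHISM of pairs in `R^♯` in place of strict similarity. (= v1 Prop. 2.20.) [cite: KudlaRapoport2013, §2.4 Proposition 2.19 (arXiv v2 p. 14)] -/
def Prop219 : Prop :=
  (∀ {S : Scheme.{0}} [IsLocallyNoetherian S] [ConnectedSpace S] (f : S ⟶ Spec (.of (𝓞 k))) (x y : C.Obj f),
      IsAwayFromTwo S → x.toNaiveObj.Iso y.toNaiveObj → (D.labelSharp f x).StrictSim (D.labelSharp f y)) ∧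
  (∀ {S : Scheme.{0}} [IsLocallyNoetherian S] [ConnectedSpace S] (f : S ⟶ Spec (.of (𝓞 k))) (x : C.Obj f)
      (F : Type) [Field F] (s : Spec (.of F) ⟶ S), IsAwayFromTwo S →
      (D.labelSharp (s ≫ f) (x.baseChange s)).StrictSim (D.labelSharp f x)) ∧
  (∀ {S : Scheme.{0}} [IsLocallyNoetherian S] [ConnectedSpace S] (f : S ⟶ Spec (.of (𝓞 k))) (y z : C.MObj f),
      IsAwayFromTwo S → y.pt.toNaiveObj.Iso z.pt.toNaiveObj → y.pt₀.Iso z.pt₀ →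
        (D.labelSharp f y.pt).Iso (D.labelSharp f z.pt)) ∧
  (∀ {S : Scheme.{0}} [IsLocallyNoetherian S] [ConnectedSpace S] (f : S ⟶ Spec (.of (𝓞 k))) (y : C.MObj f)
      (F : Type) [Field F] (s : Spec (.of F) ⟶ S), IsAwayFromTwo S →
      (D.labelSharp (s ≫ f) (y.pt.baseChange s)).Iso (D.labelSharp f y.pt))

/-! ### §2.5 (p. 15): Proposition 2.22 (ii), (iii) -/

/-- **[KR2013, Proposition 2.22 (ii)]** (p. 15; `r = 1`, `T ∈ Herm_n(O_k)_{>0}`, «`V_T = k^n` with hermitian form given by `T`»): «If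
`Diff₀(T) = {p}`, then `supp(Z(T)) ⊂ M^{V,ss}_p`, where `V ∈ R_{(n−1,1)}(k)` is the unique relevant hermitian space with
`inv_ℓ(V) = inv_ℓ(V_T)` for all finite primes `ℓ ≠ p`. Here `M^{V,ss}_p` denotes the supersingular locus in the fiber of `M^V` at
`p`.» — READING R7 (geometric points: characteristic `p`, supersingular, pair label isometric to `V`), with the existence and
uniqueness-up-to-isometry of `V` (⟨CARRIER⟩ `locInv`, `locInvMat`). (= v1 Prop. 2.23 (ii).) [cite: KudlaRapoport2013, §2.5 Proposition 2.22 (ii) (arXiv v2 p. 15)] -/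
def Prop222_ii : Prop :=
  C.r = 1 → ∀ (T : Matrix (Fin C.n) (Fin C.n) (𝓞 k)), IsPosDefHerm k T → ∀ p : ℕ, diff0 k T = {p} →
    (∃ V : HermSpace ℚ k, C.IsRelevant V ∧ ∀ ℓ : ℕ, ℓ.Prime → ℓ ≠ p → C.locInv V ℓ = C.locInvMat T ℓ) ∧
    (∀ V W : HermSpace ℚ k, C.IsRelevant V → C.IsRelevant W →
      (∀ ℓ : ℕ, ℓ.Prime → ℓ ≠ p → C.locInv V ℓ = C.locInvMat T ℓ) →
      (∀ ℓ : ℕ, ℓ.Prime → ℓ ≠ p → C.locInv W ℓ = C.locInvMat T ℓ) → HermIso k V W) ∧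
    ∀ (F : Type) [Field F] [IsAlgClosed F] (f : Spec (.of F) ⟶ Spec (.of (𝓞 k))) (z : C.ZObj f T),
      ringChar F = p ∧ C.IsSupersingular z.pt.A ∧
        ∀ V : HermSpace ℚ k, C.IsRelevant V → (∀ ℓ : ℕ, ℓ.Prime → ℓ ≠ p → C.locInv V ℓ = C.locInvMat T ℓ) →
          HermIso k (D.pairLabel f z.toMObj) V

/-- **[KR2013, Proposition 2.22 (iii)]** (p. 15; `r = 1`, `T ∈ Herm_n(O_k)_{>0}`): «If `Diff₀(T)` is empty, then, for each `p ∣ Δ`, there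
is a unique relevant hermitian space `V^{(p)} ∈ R_{(n−1,1)}(k)` for which `inv_ℓ(V^{(p)}) = inv_ℓ(V_T)` for all `ℓ ≠ p`. Then
`supp(Z(T)) ⊂ ⋃_{p ∣ Δ} M^{V^{(p)},ss}_p`.» (READING R7.) (= v1 Prop. 2.23 (iii).)
[cite: KudlaRapoport2013, §2.5 Proposition 2.22 (iii) (arXiv v2 p. 15)] -/
def Prop222_iii : Prop :=
  C.r = 1 → ∀ (T : Matrix (Fin C.n) (Fin C.n) (𝓞 k)), IsPosDefHerm k T → diff0 k T = ∅ →
    (∀ p : ℕ, IsRamifiedPrime k p →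
      (∃ V : HermSpace ℚ k, C.IsRelevant V ∧ ∀ ℓ : ℕ, ℓ.Prime → ℓ ≠ p → C.locInv V ℓ = C.locInvMat T ℓ) ∧
      (∀ V W : HermSpace ℚ k, C.IsRelevant V → C.IsRelevant W →
        (∀ ℓ : ℕ, ℓ.Prime → ℓ ≠ p → C.locInv V ℓ = C.locInvMat T ℓ) →
        (∀ ℓ : ℕ, ℓ.Prime → ℓ ≠ p → C.locInv W ℓ = C.locInvMat T ℓ) → HermIso k V W)) ∧
    ∀ (F : Type) [Field F] [IsAlgClosed F] (f : Spec (.of F) ⟶ Spec (.of (𝓞 k))) (z : C.ZObj f T),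
      ∃ p : ℕ, IsRamifiedPrime k p ∧ ringChar F = p ∧ C.IsSupersingular z.pt.A ∧
        ∀ V : HermSpace ℚ k, C.IsRelevant V → (∀ ℓ : ℕ, ℓ.Prime → ℓ ≠ p → C.locInv V ℓ = C.locInvMat T ℓ) →
          HermIso k (D.pairLabel f z.toMObj) V

end Labels

end Literature.AlgebraicGeometry.ShimuraVarieties.KudlaRapoport2013.Sec2GlobalModuliProblem

end
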